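import Mathlib
import Summits.Ventures.PercRepro2.ZMeanProof
import Summits.Ventures.PercRepro2.PendantRoot
import Summits.Ventures.PercRepro2.HMFLeaf
import Summits.Ventures.PercRepro2.HMFLeafStep
import Summits.Ventures.PercRepro2.HMFLeafInvisible
import Summits.Ventures.PercRepro2.HMFLoop
import Summits.Ventures.PercRepro2.HMFLeafRB
import Summits.Ventures.PercRepro2.HMFSureEdge
import Summits.Ventures.PercRepro2.GcTransport
import Summits.Ventures.PercRepro2.StarHMasses
import Summits.Ventures.PercRepro2.StarHXhatCells
import Summits.Ventures.PercRepro2.StarHClass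
import Summits.Ventures.PercRepro2.StarHKappaDefs

/-!
# The hub-leaf «a₃ pendant at u, N(u) = {a₁, a₂, o, b, a₃}»: (HMF) at the contracted instance and the
attachment coefficient as `kappaMassH` of the hub table at `u` (blind cell PercRepro2, night-1 g13;
NIGHT1-G13.md §3)

Let `a₃` be a leaf with edge `f = {a₃, u}`, and let the unmarked `u` carry exactly the edges `f`,
`f₁ = {u, a₁}`, `f₂ = {u, a₂}`, `f₃ = {u, o}`, `f₄ = {u, b}`.  With `f` sure and the mark moved to `u`
(`HMFSureEdge`), the instance has the mark `u` with an unmarked leaf `a₃` attached — invisible to `HMFc`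
(`HMFLeafInvisible.HMFc_update_leaf`), so the weight of `f` may be set to `0`; pinned closed is re-routed
to a loop at `a₃` (`HMFLoop.HMFc_update_zero_eq_loop`), and in the loop graph `u` carries exactly the four
star edges, so the hub theorem `StarH.HMF_star_h` applies: **`HMF (p[f ↦ 1]) … u …`**
(`HMF_contract_star_h`) — hypothesis (i) of the leaf step `HMFLeafStep.HMF_of_leaf_step`.
Hypothesis (ii), `κ ≥ 0`: `kappa_star_h` writes `κ = 4 HMFc(½) − 2 HMFc(1)` (`HMFLeafRB.kappa_eq`) as
`kappaMassH` of the hub table at `u` in the loop graph (the sure-edge relabelling `a₃ → u`, the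
invisibility of the unmarked leaf, the loop re-routing, then the seventeen hub mass lemmas and the mean
field `Xhat_star_h_cells`) — the κ-twin of `StarH.HMFc_star_h`; `HMF_star_leaf_h_of_kappa` closes the
class from `0 ≤ kappaMassH (table)`.
-/

open scoped Classical

namespace Summit.Ventures.PercRepro2

open UnionCluster CovForm PendantRoot RECM HMFLeafInvisible HMFSureEdge StarGlue

namespace HMFStarLeafH

variable {V : Type*} {E : Type*} [Fintype E] [DecidableEq E] [Fintype V] [DecidableEq V]
  {R : Type*} [Field R] [LinearOrder R] [IsStrictOrderedRing R]

variable (p : E → R) (ends : E → Sym2 V) {f f₁ f₂ f₃ f₄ : E} {a₃ u a₁ a₂ o b : V}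

open StarO (pOut)

omit [Fintype E] [Fintype V] [DecidableEq V] in
/-- In the loop graph the star at `u` is `{f₁, f₂, f₃, f₄}`. -/
lemma hstar_loop (hf : ends f = s(a₃, u))
    (hstar : ∀ e, u ∈ ends e → e = f ∨ e = f₁ ∨ e = f₂ ∨ e = f₃ ∨ e = f₄) (h3u : a₃ ≠ u) :
    ∀ e, u ∈ (Function.update ends f s(a₃, a₃)) e → e = f₁ ∨ e = f₂ ∨ e = f₃ ∨ e = f₄ := by
  intro e he
  by_cases hef : e = f
  · subst hef
    rw [Function.update_self] at he
    rcases Sym2.mem_iff.1 he with h | h <;> exact absurd h.symm h3u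
  · rw [Function.update_of_ne hef] at he
    rcases hstar e he with h | h | h | h | h
    · exact absurd h hef
    · exact Or.inl h
    · exact Or.inr (Or.inl h)
    · exact Or.inr (Or.inr (Or.inl h))
    · exact Or.inr (Or.inr (Or.inr h))

omit [Fintype E] [Fintype V] [DecidableEq V] in
/-- The loop graph `ends[f ↦ s(a₃, a₃)]` carries the star `{f₁, f₂, f₃, f₄}` at `u`. -/
lemma star_loop (hf : ends f = s(a₃, u)) (hf₁ : ends f₁ = s(u, a₁)) (hf₂ : ends f₂ = s(u, a₂))
    (hf₃ : ends f₃ = s(u, o)) (hf₄ : ends f₄ = s(u, b))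
    (hstar : ∀ e, u ∈ ends e → e = f ∨ e = f₁ ∨ e = f₂ ∨ e = f₃ ∨ e = f₄)
    (h3u : a₃ ≠ u) (h31 : a₃ ≠ a₁) (h32 : a₃ ≠ a₂) (h3o : a₃ ≠ o) (h3b : a₃ ≠ b) :
    (Function.update ends f s(a₃, a₃)) f₁ = s(u, a₁) ∧
      (Function.update ends f s(a₃, a₃)) f₂ = s(u, a₂) ∧
      (Function.update ends f s(a₃, a₃)) f₃ = s(u, o) ∧
      (Function.update ends f s(a₃, a₃)) f₄ = s(u, b) ∧
      ∀ e, u ∈ (Function.update ends f s(a₃, a₃)) e → e = f₁ ∨ e = f₂ ∨ e = f₃ ∨ e = f₄ := by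
  have hne : ∀ {g : E} {x : V}, ends g = s(u, x) → a₃ ≠ x → f ≠ g := by
    intro g x hg hx h
    rw [h, hg] at hf
    rcases Sym2.eq_iff.1 hf with ⟨h', _⟩ | ⟨_, h'⟩
    · exact h3u h'.symm
    · exact hx h'.symm
  exact ⟨by rw [Function.update_of_ne (Ne.symm (hne hf₁ h31)), hf₁],
    by rw [Function.update_of_ne (Ne.symm (hne hf₂ h32)), hf₂],
    by rw [Function.update_of_ne (Ne.symm (hne hf₃ h3o)), hf₃],
    by rw [Function.update_of_ne (Ne.symm (hne hf₄ h3b)), hf₄], hstar_loop ends hf hstar h3u⟩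

/-- **(HMF) at the contracted instance with the mark at `u`**: `u` adjacent only to the four marks and
the leaf `a₃`; with `f = {a₃, u}` sure, the hub theorem gives the mean-field row. -/
theorem HMF_contract_star_h (hp : IsProbVec p) (hf : ends f = s(a₃, u))
    (hf₁ : ends f₁ = s(u, a₁)) (hf₂ : ends f₂ = s(u, a₂)) (hf₃ : ends f₃ = s(u, o))
    (hf₄ : ends f₄ = s(u, b)) (hleaf : ∀ e, a₃ ∈ ends e → e = f)
    (hstar : ∀ e, u ∈ ends e → e = f ∨ e = f₁ ∨ e = f₂ ∨ e = f₃ ∨ e = f₄) (h3u : a₃ ≠ u)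
    (h3o : a₃ ≠ o) (h31 : a₃ ≠ a₁) (h32 : a₃ ≠ a₂) (h3b : a₃ ≠ b) (hu1 : u ≠ a₁) (hu2 : u ≠ a₂)
    (huo : u ≠ o) (hub : u ≠ b) (h12 : f₁ ≠ f₂) (h13 : f₁ ≠ f₃) (h14 : f₁ ≠ f₄) (h23 : f₂ ≠ f₃)
    (h24 : f₂ ≠ f₄) (h34 : f₃ ≠ f₄) :
    HMF (Function.update p f 1) ends o a₁ a₂ u b := by
  unfold HMF
  -- the unmarked leaf `a₃` is invisible: move the weight of `f` to `0`
  rw [HMFLeafInvisible.HMFc_update_leaf p hf hleaf h3u h3o h31 h32 h3u h3b 1,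
    ← HMFLeafInvisible.HMFc_update_leaf p hf hleaf h3u h3o h31 h32 h3u h3b 0,
    HMFLoop.HMFc_update_zero_eq_loop p ends f a₃ o a₁ a₂ u b]
  obtain ⟨hf₁', hf₂', hf₃', hf₄', hstar'⟩ := star_loop ends hf hf₁ hf₂ hf₃ hf₄ hstar h3u h31 h32 h3o h3b
  exact StarH.HMF_star_h p (Function.update ends f s(a₃, a₃)) hp hf₁' hf₂' hf₃' hf₄' hstar' hu1 hu2
    huo hub h12 h13 h14 h23 h24 h34

/-- `kappaMassH` of the hub table of the weights `p` on `ends` at the centre `u` (the ten cells of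
`pOut p ends u`, `G_ob, G′_ob`, `X₀ = termW {u}` as in `HMFc_star_h`). -/
noncomputable def kappaTableH (p : E → R) (ends : E → Sym2 V) (u o a₁ a₂ b : V) (al be r s : R) : R :=
  StarH.kappaMassH (prob (pOut p ends u) (StarH.cLL ends a₁ a₂ o b)) (prob (pOut p ends u) (StarH.cLH ends a₁ a₂ o b))
    (prob (pOut p ends u) (StarH.cLN ends a₁ a₂ o b)) (prob (pOut p ends u) (StarH.cHL ends a₁ a₂ o b))
    (prob (pOut p ends u) (StarH.cHH ends a₁ a₂ o b)) (prob (pOut p ends u) (StarH.cHN ends a₁ a₂ o b))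
    (prob (pOut p ends u) (StarH.cNL ends a₁ a₂ o b)) (prob (pOut p ends u) (StarH.cNH ends a₁ a₂ o b))
    (prob (pOut p ends u) (StarH.cNNt ends a₁ a₂ o b)) (prob (pOut p ends u) (StarH.cNNs ends a₁ a₂ o b))
    (PocketConn.Eprod' (pOut p ends u) ends o a₁ a₂ b)
    (PocketConn.Eprod' (pOut p ends u) ends o a₂ a₁ b)
    (termW p ends o a₁ a₂ b {u}) al be r s

section Kappa

variable {p ends}
variable (hp : IsProbVec p) (hf : ends f = s(a₃, u)) (hf₁ : ends f₁ = s(u, a₁)) (hf₂ : ends f₂ = s(u, a₂))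
  (hf₃ : ends f₃ = s(u, o)) (hf₄ : ends f₄ = s(u, b)) (hleaf : ∀ e, a₃ ∈ ends e → e = f)
  (hstar : ∀ e, u ∈ ends e → e = f ∨ e = f₁ ∨ e = f₂ ∨ e = f₃ ∨ e = f₄) (h3u : a₃ ≠ u)
  (h3o : a₃ ≠ o) (h31 : a₃ ≠ a₁) (h32 : a₃ ≠ a₂) (h3b : a₃ ≠ b) (hu1 : u ≠ a₁) (hu2 : u ≠ a₂)
  (huo : u ≠ o) (hub : u ≠ b) (h12 : f₁ ≠ f₂) (h13 : f₁ ≠ f₃) (h14 : f₁ ≠ f₄) (h23 : f₂ ≠ f₃)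
  (h24 : f₂ ≠ f₄) (h34 : f₃ ≠ f₄)

include hp hf hf₁ hf₂ hf₃ hf₄ hleaf hstar h3u h3o h31 h32 h3b hu1 hu2 huo hub h12 h13 h14 h23 h24 h34

/-- **The attachment coefficient of the hub-leaf is `kappaMassH` of the hub table at `u`** in the loop
graph `ends' = ends[f ↦ s(a₃, a₃)]`: `HMFLeafRB.kappa_eq`, the sure-edge relabelling `a₃ → u`, the
invisibility of the unmarked leaf, the loop re-routing, and the hub mass lemmas. -/
theorem kappa_star_h :
    4 * HMFc (Function.update p f (1 / 2)) ends o a₁ a₂ a₃ b -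
        2 * HMFc (Function.update p f 1) ends o a₁ a₂ a₃ b =
      kappaTableH p (Function.update ends f s(a₃, a₃)) u o a₁ a₂ b (p f₁) (p f₂) (p f₃) (p f₄) := by
  unfold kappaTableH
  rw [HMFLeafStep.kappa_eq p ends hp hf hleaf h3u h31 h32 h3o.symm h3b.symm]
  -- the loop graph and its star at `u`
  set ends' := Function.update ends f s(a₃, a₃) with hends'
  obtain ⟨hf₁', hf₂', hf₃', hf₄', hstar'⟩ := star_loop ends hf hf₁ hf₂ hf₃ hf₄ hstar h3u h31 h32 h3o h3b
  -- step 1: the sure edge relabels the mark `a₃ → u` in the contracted masses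
  have hq1 : Function.update p f 1 f = 1 := by simp
  have hqp : IsProbVec (Function.update p f 1) := hp.update f zero_le_one le_rfl
  have hPD : ∀ X : Set (Config E), prob (Function.update p f 1) (PDEvent ends a₁ a₂ a₃ ∩ X) =
      prob (Function.update p f 1) (PDEvent ends a₁ a₂ u ∩ X) := fun X =>
    prob_eq_of_inter_open _ hqp hq1 (inter_open_congr (PD_inter_open hf a₁ a₂))
  have hPDu : prob (Function.update p f 1) (PDEvent ends a₁ a₂ a₃) =
      prob (Function.update p f 1) (PDEvent ends a₁ a₂ u) :=
    prob_eq_of_inter_open _ hqp hq1 (PD_inter_open hf a₁ a₂)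
  have hT : ∀ X : Set (Config E), prob (Function.update p f 1) (TEvent ends a₁ a₂ a₃ ∩ X) =
      prob (Function.update p f 1) (TEvent ends a₁ a₂ u ∩ X) := fun X =>
    prob_eq_of_inter_open _ hqp hq1 (inter_open_congr (T_inter_open hf a₁ a₂))
  have hTr : ∀ X : Set (Config E), prob (Function.update p f 1) (X ∩ TEvent ends a₁ a₂ a₃) =
      prob (Function.update p f 1) (X ∩ TEvent ends a₁ a₂ u) := fun X =>
    prob_eq_of_inter_open _ hqp hq1 (inter_open_congr' (T_inter_open hf a₁ a₂))
  have hTu : prob (Function.update p f 1) (TEvent ends a₁ a₂ a₃) =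
      prob (Function.update p f 1) (TEvent ends a₁ a₂ u) :=
    prob_eq_of_inter_open _ hqp hq1 (T_inter_open hf a₁ a₂)
  have hT' : ∀ X : Set (Config E), prob (Function.update p f 1) (TEvent ends a₂ a₁ a₃ ∩ X) =
      prob (Function.update p f 1) (TEvent ends a₂ a₁ u ∩ X) := fun X =>
    prob_eq_of_inter_open _ hqp hq1 (inter_open_congr (T_inter_open hf a₂ a₁))
  have hT'u : prob (Function.update p f 1) (TEvent ends a₂ a₁ a₃) =
      prob (Function.update p f 1) (TEvent ends a₂ a₁ u) :=
    prob_eq_of_inter_open _ hqp hq1 (T_inter_open hf a₂ a₁)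
  have hX : ∀ W : Finset V, prob (Function.update p f 1) (clusterEvent ends a₃ (↑W : Set V)) =
      prob (Function.update p f 1) (clusterEvent ends u (↑W : Set V)) := fun W =>
    prob_eq_of_inter_open _ hqp hq1 (cluster_inter_open hf (↑W : Set V))
  -- the mean field: relabel, drop the leaf, re-route to the loop
  have hXhat : Xhat (Function.update p f 1) ends o a₁ a₂ a₃ b = Xhat p ends' o a₁ a₂ u b := by
    calc Xhat (Function.update p f 1) ends o a₁ a₂ a₃ b
        = Xhat (Function.update p f 1) ends o a₁ a₂ u b := by
          rw [Xhat_eq_sum, Xhat_eq_sum]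
          exact Finset.sum_congr rfl fun W _ => by rw [hX W]
      _ = Xhat p ends o a₁ a₂ u b :=
          Xhat_update_leaf p hf hleaf h3u h3o h31 h32 h3u.symm h3b 1
      _ = Xhat (Function.update p f 0) ends o a₁ a₂ u b :=
          (Xhat_update_leaf p hf hleaf h3u h3o h31 h32 h3u.symm h3b 0).symm
      _ = Xhat p ends' o a₁ a₂ u b := HMFLoop.Xhat_update_zero_eq_loop p ends f a₃ o a₁ a₂ u b
  simp only [CovForm.Do, massM2, deltaT, CovForm.EQ3, CovForm.EQ3o, hPD, hPDu, hT, hTr, hTu, hT',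
    hT'u, hXhat]
  -- step 2: the unmarked leaf is invisible: every remaining mass is `f`-free
  have hc : ∀ v w : V, v ≠ a₃ → w ≠ a₃ → Free f (connEvent ends v w) := fun v w hv hw =>
    free_connEvent hf hleaf h3u hv hw
  have hQ : Free f (avoidAll ends a₂ {a₁}) := by
    rw [avoidAll_eq_compl]; exact (hc a₁ a₂ h31.symm h32.symm).compl
  have hPDf : Free f (PDEvent ends a₁ a₂ u) := by
    unfold PDEvent Dtilde UnionCluster.inU
    exact (hc a₁ a₂ h31.symm h32.symm).compl.inter
      (free_union (hc u a₁ h3u.symm h31.symm) (hc u a₂ h3u.symm h32.symm)).compl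
  have hTf : Free f (TEvent ends a₁ a₂ u) := by
    unfold TEvent
    exact (hc a₂ a₁ h32.symm h31.symm).compl.inter (hc a₂ u h32.symm h3u.symm)
  have hT'f : Free f (TEvent ends a₂ a₁ u) := by
    unfold TEvent
    exact (hc a₁ a₂ h31.symm h32.symm).compl.inter (hc a₁ u h31.symm h3u.symm)
  have key : ∀ A : Set (Config E), Free f A →
      prob (Function.update p f 1) A = prob (Function.update p f 0) A := fun A hA => by
    rw [PendantEdm.prob_update_of_free p hA 1, PendantEdm.prob_update_of_free p hA 0]
  have key0 : ∀ A : Set (Config E), Free f A → prob p A = prob (Function.update p f 0) A :=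
    fun A hA => (PendantEdm.prob_update_of_free p hA 0).symm
  simp only [key _ hPDf, key _ hTf, key _ hT'f,
    key _ (hPDf.inter (hc a₁ o h31.symm h3o.symm)), key _ (hPDf.inter (hc a₂ o h32.symm h3o.symm)),
    key _ (hPDf.inter (hc a₂ b h32.symm h3b.symm)),
    key _ ((hc a₂ b h32.symm h3b.symm).inter hTf), key _ ((hc a₁ b h31.symm h3b.symm).inter hTf),
    key _ (hT'f.inter (hc a₁ o h31.symm h3o.symm)), key _ (hT'f.inter (hc a₂ o h32.symm h3o.symm)),
    key _ (hTf.inter (hc a₁ o h31.symm h3o.symm)), key _ (hTf.inter (hc a₂ o h32.symm h3o.symm)),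
    key0 _ hQ, key0 _ (hQ.inter (hc a₁ o h31.symm h3o.symm)),
    key0 _ (hQ.inter (hc a₂ o h32.symm h3o.symm)), key0 _ (hQ.inter (hc a₂ b h32.symm h3b.symm)),
    key0 _ (hQ.inter (hc a₁ b h31.symm h3b.symm))]
  -- step 3: pinned closed = the loop graph
  have hH : ∀ ω x z, Conn ends (Function.update ω f false) x z ↔ Conn ends' ω (id x) (id z) :=
    fun ω x z => conn_update_false_iff_loop ends f a₃ ω x z
  simp only [prob_update_zero_eq_preimage, Set.preimage_inter, preimage_PDEvent hH,
    preimage_TEvent hH, preimage_connEvent hH, preimage_avoidAll_singleton hH, id]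
  -- step 4: the hub masses at the star `{f₁, f₂, f₃, f₄}` of `u` in the loop graph
  have mQ := StarH.mass_Q p ends' hf₁' hf₂' hf₃' hf₄' hstar' hu1 hu2 huo hub h12 h13 h14 h23 h24 h34
  have mPD := StarH.mass_PD p ends' hf₁' hf₂' hf₃' hf₄' hstar' hu1 hu2 huo hub h12 h13 h14 h23 h24 h34
  have mPDoL := StarH.mass_PDoL p ends' hf₁' hf₂' hf₃' hf₄' hstar' hu1 hu2 huo hub h12 h13 h14 h23 h24 h34
  have mPDoH := StarH.mass_PDoH p ends' hf₁' hf₂' hf₃' hf₄' hstar' hu1 hu2 huo hub h12 h13 h14 h23 h24 h34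
  have mPDbH := StarH.mass_PDbH p ends' hf₁' hf₂' hf₃' hf₄' hstar' hu1 hu2 huo hub h12 h13 h14 h23 h24 h34
  have mT := StarH.mass_T p ends' hf₁' hf₂' hf₃' hf₄' hstar' hu1 hu2 huo hub h12 h13 h14 h23 h24 h34
  have mTbH := StarH.mass_TbH p ends' hf₁' hf₂' hf₃' hf₄' hstar' hu1 hu2 huo hub h12 h13 h14 h23 h24 h34
  have mTbL := StarH.mass_TbL p ends' hf₁' hf₂' hf₃' hf₄' hstar' hu1 hu2 huo hub h12 h13 h14 h23 h24 h34
  have mToL := StarH.mass_ToL p ends' hf₁' hf₂' hf₃' hf₄' hstar' hu1 hu2 huo hub h12 h13 h14 h23 h24 h34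
  have mToH := StarH.mass_ToH p ends' hf₁' hf₂' hf₃' hf₄' hstar' hu1 hu2 huo hub h12 h13 h14 h23 h24 h34
  have mTp := StarH.mass_Tp p ends' hf₁' hf₂' hf₃' hf₄' hstar' hu1 hu2 huo hub h12 h13 h14 h23 h24 h34
  have mTpoL := StarH.mass_TpoL p ends' hf₁' hf₂' hf₃' hf₄' hstar' hu1 hu2 huo hub h12 h13 h14 h23 h24 h34
  have mTpoH := StarH.mass_TpoH p ends' hf₁' hf₂' hf₃' hf₄' hstar' hu1 hu2 huo hub h12 h13 h14 h23 h24 h34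
  have mQoL := StarH.mass_QoL p ends' hf₁' hf₂' hf₃' hf₄' hstar' hu1 hu2 huo hub h12 h13 h14 h23 h24 h34
  have mQoH := StarH.mass_QoH p ends' hf₁' hf₂' hf₃' hf₄' hstar' hu1 hu2 huo hub h12 h13 h14 h23 h24 h34
  have mQbH := StarH.mass_QbH p ends' hf₁' hf₂' hf₃' hf₄' hstar' hu1 hu2 huo hub h12 h13 h14 h23 h24 h34
  have mQbL := StarH.mass_QbL p ends' hf₁' hf₂' hf₃' hf₄' hstar' hu1 hu2 huo hub h12 h13 h14 h23 h24 h34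
  have mX := StarH.Xhat_star_h_cells p ends' hf₁' hf₂' hf₃' hf₄' hstar' hu1 hu2 huo hub h12 h13 h14 h23
    h24 h34
  have eT1 : connEvent ends' a₂ b ∩ TEvent ends' a₁ a₂ u = TEvent ends' a₁ a₂ u ∩ connEvent ends' a₂ b :=
    Set.inter_comm _ _
  have eT2 : connEvent ends' a₁ b ∩ TEvent ends' a₁ a₂ u = TEvent ends' a₁ a₂ u ∩ connEvent ends' a₁ b :=
    Set.inter_comm _ _
  rw [eT1, eT2, mQ, mPD, mPDoL, mPDoH, mPDbH, mTbH, mTbL, mT, mToL, mToH, mTp, mTpoL, mTpoH, mQoL,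
    mQoH, mQbH, mQbL, mX]
  unfold StarH.kappaMassH
  ring

/-- **(HMF) on the hub-leaf from the sign of the attachment coefficient**: hypothesis (i) of the leaf
step is `HMF_contract_star_h`, hypothesis (ii) is `kappa_star_h` together with `0 ≤ kappaMassH (table)`. -/
theorem HMF_star_leaf_h_of_kappa
    (hk : 0 ≤ kappaTableH p (Function.update ends f s(a₃, a₃)) u o a₁ a₂ b (p f₁) (p f₂) (p f₃) (p f₄)) :
    HMF p ends o a₁ a₂ a₃ b := by
  have hrel := HMFSureEdge.HMFc_relabel_of_sure (Function.update p f 1) ends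
    (hp.update f zero_le_one le_rfl) hf (by simp) o a₁ a₂ b
  refine HMFLeafStep.HMF_of_leaf_step p ends hp hf hleaf h3u h31 h32 h3o.symm h3b.symm ?_ ?_
  · rw [hrel]
    exact HMF_contract_star_h p ends hp hf hf₁ hf₂ hf₃ hf₄ hleaf hstar h3u h3o h31 h32 h3b hu1 hu2 huo
      hub h12 h13 h14 h23 h24 h34
  · rw [kappa_star_h hp hf hf₁ hf₂ hf₃ hf₄ hleaf hstar h3u h3o h31 h32 h3b hu1 hu2 huo hub h12 h13 h14
      h23 h24 h34]
    exact hk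

end Kappa

end HMFStarLeafH

end Summit.Ventures.PercRepro2
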